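/-
Copyright: the b2b-balaban cell (near-miss cell 7), T⁴-continuum fan-out; row NE7b ROUND-2 swarm, seat
t4-ne7b-formalise-leaf-08 (gen 11) — row S12o «CONCAVE ENTROPY REPAIR» part (iii) (R-OWNER-23-15 (2), division of labour
journal l.17953), sibling 1∕3: the multiplicity INSTANCE made GENERIC in the class-linear constant.  Released under the
licence of the surrounding project.
-/
import Summits.QuantumFields.BalabanUV.T4Continuum.Support.HistoryAssemblyMultInstance

/-!
# History assembly, the multiplicity instance GENERIC in the twin END's constant (row S12o (iii), sibling 1∕3)

Summits-side support leaf of the T⁴-continuum cell (rung (B)+1 on a FINITE torus only; NOT infinite volume, NOT the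
mass gap, NOT the Clay statement; NOT a proof of the spine estimate NE7b).  Row NE7b, route «COUNT», row S12o
«CONCAVE ENTROPY REPAIR» (owner t4-ne7b-p1 gen 23, R-OWNER-23-15): the smallness census of record (F-leaf10g12-1 +
F-leaf08g11-1) locates the class-linear constant `Θ ≈ 2.4·10²⁷` of the END of record in two pointwise linearisations; the
repair lands CONCAVE siblings of the count's chain with a new constant `ΘJc`.  Part (iii) = the instance + junction
siblings.  THIS FILE makes the instance `HistoryAssemblyMultInstance.card_koccOf_le_exp` (leaf-03 g3) GENERIC: the twin
END's inequality enters as a HYPOTHESIS `htwin` for an ARBITRARY constant `Θ₀`, so that ONE proof serves the tree's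
constant (fidelity `example` below, statement verbatim = the tree's `card_koccOf_le_exp`) and every sibling constant — row
S12o (ii)'s `HistoryJoinsPlacedTwinConcave.card_S_sortR_le_exp_pow'` supplies `htwin` at `Θ₀ := ΘJc d sS θc` by a
three-line lambda (the pattern is the proof of the fidelity `example` at the end of this file).  [folklore] bookkeeping over OUR carriers: the
proof is the tree's, re-lettered (imports `HistoryAssemblyMultInstance` and re-uses its §1–§2 BY NAME); nothing is quoted
from print, nothing printed is asserted, no `[cite:]` tag, no `Prop`-valued fact minted, no definition; constants
symbolic (trigger c2∕c6); no exit ∕ socket ∕ `HistoryConstants*` ∕ END file is edited (c3) — a SIBLING module.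

WHAT.  `card_koccOf_le_exp_of_twin`: binders of `card_koccOf_le_exp` VERBATIM minus {`hE₂`, `hE₃`, `sS hsS hsmall`,
`θc hθc0 hθc1 hθcs`} (they only feed the twin END), plus `{Θ₀}`, **`htwin`** (the twin END's conclusion shape at `Θ₀`,
universally over cutoff `K ≥ K₀`, term `τ ∈ T K`, live `c ∈ liveC K τ`, template capacity `Mz`, root data `c₀ ρ z`, under `ConsistentTLE` and
`step ≤ K` — exactly what the instance hands the twin END) and `hθ : Θ₀ + 8·2^d·log(2d+1) ≤ θ`; conclusion VERBATIM.
the fidelity `example`: the tree's statement, proved from the generic one + `card_S_sortR_le_exp_pow`.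
Siblings 2∕3 (`HistoryRealiseCellsRunMultEndPTwin` ∕ `…PDTwin`): END v3′ ∕ v3.1′ generic in `Θ₀` over this file.

HONEST: re-lettering of OUR bookkeeping; the END of record, the exits, the socket shape `θ·birthLinT` and the headline's
Prop are untouched (only the size of the hidden `g₁` is what row S12o moves); nothing of H3 ∕ (B) ∕ BetaPertHyp
discharged; NE7b NOT proved; spine 0∕9.  HONEST DEPENDENCY (cell): continuum YM on T⁴ ⇐ BetaPertH ∧ nine spine estimates
(0/9 proved); BetaPertH ⇐ (D1) ∧ (D4) ∧ CAP+tail; G-an2-4 gates asym, D1 and NE2/3/4.  This file changes none of it.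
-/

open Finset
open Literature.MathematicalPhysics.QuantumFieldTheory.Balaban1983to89
open Literature.MathematicalPhysics.QuantumFieldTheory.Balaban1983to89.B13ScaleTransfer (Pt FaceConnected)
open Literature.MathematicalPhysics.QuantumFieldTheory.Balaban1983to89.B16SProfile (DropCtl)
open T4PersistenceDictionary T4PrintedShapeBanking T4TaggedShapeBanking T4PartnerMultiplicity T4BranchingRecordsGas
open Summit.QuantumFields.BalabanUV.T4Continuum.ZoneTorus
open Summit.QuantumFields.BalabanUV.T4Continuum.ZoneSkeleton
open Summit.QuantumFields.BalabanUV.T4Continuum.HistoryZones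
open Summit.QuantumFields.BalabanUV.T4Continuum.HistoryZoneEvolve (cth)
open Summit.QuantumFields.BalabanUV.T4Continuum.HistoryAdmissible
open Summit.QuantumFields.BalabanUV.T4Continuum.HistoryRealise
open Summit.QuantumFields.BalabanUV.T4Continuum.HistoryRealiseCells
open Summit.QuantumFields.BalabanUV.T4Continuum.HistoryRealiseCellsRun
open Summit.QuantumFields.BalabanUV.T4Continuum.HistoryRealiseDistinct
open Summit.QuantumFields.BalabanUV.T4Continuum.HistoryGen
open Summit.QuantumFields.BalabanUV.T4Continuum.HistoryJoins
open Summit.QuantumFields.BalabanUV.T4Continuum.HistoryJoinsAdm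
open Summit.QuantumFields.BalabanUV.T4Continuum.HistoryAssemblyTerms
open Summit.QuantumFields.BalabanUV.T4Continuum.HistoryAssemblyPedigree
open Summit.QuantumFields.BalabanUV.T4Continuum.HistoryAssemblyMultKey
open Summit.QuantumFields.BalabanUV.T4Continuum.HistoryAssemblyMultLetters
open Summit.QuantumFields.BalabanUV.T4Continuum.HistoryRegionTemplates
open Summit.QuantumFields.BalabanUV.T4Continuum.HistoryJoinsTemplates
open Summit.QuantumFields.BalabanUV.T4Continuum.HistoryJoinsPlacedZone
open Summit.QuantumFields.BalabanUV.T4Continuum.HistoryJoinsPlacedValue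
open Summit.QuantumFields.BalabanUV.T4Continuum.HistoryJoinsPlacedMember
open Summit.QuantumFields.BalabanUV.T4Continuum.HistoryJoinsPlacedTwin
open Summit.QuantumFields.BalabanUV.T4Continuum.HistoryJoinsPlacedMult
open Summit.QuantumFields.BalabanUV.T4Continuum.HistorySiblingEntropyBridge
open Summit.QuantumFields.BalabanUV.T4Continuum.HistoryBankingLE
open Summit.QuantumFields.BalabanUV.T4Continuum.HistoryConstants
open Summit.QuantumFields.BalabanUV.T4Continuum.HistoryCaps
open Summit.QuantumFields.BalabanUV.T4Continuum.HistoryZoneMassLawLevels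
open Summit.QuantumFields.BalabanUV.T4Continuum.HistoryRenewalsCost
open Summit.QuantumFields.BalabanUV.T4Continuum.PlacementSkeleton
open Summit.QuantumFields.BalabanUV.T4Continuum.HistoryAssemblyMultInstance

namespace Summit.QuantumFields.BalabanUV.T4Continuum.HistoryAssemblyMultInstanceTwin

noncomputable section

open scoped Classical

section Instance

variable {ι α π : Type*} [DecidableEq α] [DecidableEq π] {d n L K₀ : ℕ} {C : T4PrintedShapeBanking.Consts}
  {s R : ℕ → ℕ → ℕ} {T : ℕ → Finset ι} {ped : ℕ → ι → Pedigree α π} {cellP : ℕ → ι → π → Pt d × Finset (Pt d)}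
  {liveC : ℕ → ι → Finset α} {Zd : ℕ → ι → α → Finset (Pt d)}

/-- **ROW S6g′'s INSTANCE, GENERIC IN THE CLASS-LINEAR CONSTANT** (row S12o (iii)): the tree's
`HistoryAssemblyMultInstance.card_koccOf_le_exp` (p-of-record, §3 there) with the twin END's bound taken as the HYPOTHESIS
`htwin` for an arbitrary constant `Θ₀` — so the same instance serves the tree's `ΘJ d sS θc` (the fidelity `example` below)
and every sibling constant (the concave `ΘJc` of row S12o (ii), or any later repair) WITHOUT another copy of this proof
(fidelity: the `example` after it re-derives the tree's theorem). Conclusion and every other binder VERBATIM; the stride ∕ decay side conditions and the floor sign `hE₂`∕`hE₃` move into the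
supplier of `htwin`. [folklore] -/
theorem card_koccOf_le_exp_of_twin (hn : 0 < n) (hL0 : 0 < L) (hL4 : 4 ≤ L) (hn₁ : 13 ≤ C.n₁)
    {M : ℕ → ℕ} (hM : ∀ K, 1 ≤ M K)
    (hs : ∀ K, K₀ ≤ K → ∀ t, s K (t + 1) ≤ s K t) (hdrop : ∀ K, K₀ ≤ K → ∀ m, DropCtl (s K) m)
    (hR1 : ∀ K, K₀ ≤ K → ∀ t, 1 ≤ R K t)
    (H : RealisedDomainsR L s n K₀ R T ped cellP liveC Zd)
    (hstep : ∀ K, K₀ ≤ K → ∀ τ ∈ T K, ∀ c ∈ liveC K τ, (ped K τ).step c ≤ K)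
    (hMf : ∀ K, K₀ ≤ K → ∀ τ ∈ T K, ∀ c ∈ liveC K τ, ∀ bz ∈ ((ped K τ).toPGen (cellP K τ) c).pbirths,
      tcap d bz.1.fat ≤ M K)
    (jstar : ℕ → ℕ)
    (hdis : ∀ K, K₀ ≤ K → ∀ τ ∈ badTerms (memOf ped liveC (cellOfR n L s ped cellP)) jstar T K, ∀ c ∈ liveC K τ,
      (physV n L hn hL0 M hM s ped cellP K τ c).Nodup)
    -- THE TWIN BOUND AS A HYPOTHESIS, for an arbitrary class-linear constant `Θ₀` (supplied by the tree's twin END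
    -- `HistoryJoinsPlacedTwin.card_S_sortR_le_exp_pow` at `Θ₀ := ΘJ d sS θc`, or by any sibling of it)
    {Θ₀ : ℝ}
    (htwin : ∀ K, K₀ ≤ K → ∀ τ ∈ T K, ∀ c ∈ liveC K τ,
      ConsistentTLE Prod.fst C K (R K) ((ped K τ).genT c) → (ped K τ).step c ≤ K →
      ∀ (Mz Dz : ℕ) (c₀ : TCell d (n * L ^ K) × Template d Mz)
        (ρ : (Addr Dz → TCell d (n * L ^ K) × Template d Mz) → ℕ) (z : TCell d (n * L ^ K) × Template d Mz),
      ((S (zoneP n L K (levelOf (s K) K) 32 c₀) ρ c₀ PEv.step ((ped K τ).sortR.gen c) z).card : ℝ) ≤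
        Real.exp (Θ₀ * bsum (fun b => ((b.fat : ℕ) : ℝ) + 1) ((ped K τ).gen c) +
            8 / C.E₂ * totalCostT Prod.fst C K (R K) ((ped K τ).genT c)) *
          (((L : ℝ) ^ d) * Real.exp 4) ^ partnerAges PEv.step ((ped K τ).gen c))
    {θ : ℝ} (hθ : Θ₀ + 8 * 2 ^ d * Real.log (2 * d + 1) ≤ θ)
    {K : ℕ} (hK : K₀ ≤ K) {τ : ι} (hτ : τ ∈ badTerms (memOf ped liveC (cellOfR n L s ped cellP)) jstar T K)
    {c : α} (hc : c ∈ liveC K τ) :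
    ((koccOf ped liveC (cellOfR n L s ped cellP) (physV n L hn hL0 M hM s ped cellP) jstar T K
        (kslot (keyOf ped (cellOfR n L s ped cellP) (physV n L hn hL0 M hM s ped cellP) K τ c))).card : ℝ) ≤
      Real.exp (θ * birthLinT Prod.fst ((ped K τ).genT c) +
          (8 / C.E₂ * totalCostT Prod.fst C K (R K) ((ped K τ).genT c) +
            4 * (partnerAges (PEv.step ∘ Prod.fst) ((ped K τ).genT c) : ℝ))) *
        ((L : ℝ) ^ d) ^ partnerAges (PEv.step ∘ Prod.fst) ((ped K τ).genT c) := by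
  -- letters
  have hL3 : 3 ≤ L := le_trans (by norm_num) hL4
  have hτT : τ ∈ T K := (mem_badTerms.1 hτ).1
  -- the reading's fields at this run
  have hH : ∀ τ ∈ T K, ∀ c, (ped K τ).HeadOldest c := fun τ hτ => H.headOldest K hK τ hτ
  have hRS : ∀ τ ∈ T K, (ped K τ).RenewDated := fun τ hτ => H.renew_step K hK τ hτ
  have hreal : ∀ τ ∈ T K, ∀ c ∈ liveC K τ, ∃ Z, Realises L (s K) (R K) ((ped K τ).toPGen (cellP K τ) c) Z ∧
      ((ped K τ).toPGen (cellP K τ) c).lastStep ≤ K :=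
    fun τ hτ c hc => ⟨Zd K τ c, (H.real K hK τ hτ c hc).1, (H.real K hK τ hτ c hc).2.1⟩
  -- the auxiliary count data: depth, junk value, tie-break order (the bound does not depend on them)
  have hD : ∀ a ∈ baddr ((ped K τ).sortR.gen c), a.length ≤ (baddr ((ped K τ).sortR.gen c)).sup List.length :=
    fun a ha => Finset.le_sup (f := List.length) ha
  let c₀ : TCell d (n * L ^ K) × Template d (M K) := (fun _ => ⟨0, side_pos hn hL0 K⟩, Template.zero (hM K))
  let ρ : (Addr ((baddr ((ped K τ).sortR.gen c)).sup List.length) → TCell d (n * L ^ K) × Template d (M K)) → ℕ :=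
    fun f => (Fintype.equivFin _ f : ℕ)
  have hρ : Function.Injective ρ := fun f f' h => (Fintype.equivFin _).injective (Fin.ext h)
  -- the twin END, uniformly in the root datum
  obtain ⟨hre, hpend⟩ := H.real K hK τ hτT c hc
  have hcons : ConsistentTLE Prod.fst C K (R K) ((ped K τ).genT c) :=
    consistentTLE_genT_of_realises hL4 (hdrop K hK) (hR1 K hK) C hn₁ (ped K τ) (cellP K τ)
      (H.renew_step K hK τ hτT) hre hpend.1
  have htwin : ∀ z, ((S (zoneP n L K (levelOf (s K) K) 32 c₀) ρ c₀ PEv.step ((ped K τ).sortR.gen c) z).card : ℝ) ≤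
      Real.exp (Θ₀ * bsum (fun b => ((b.fat : ℕ) : ℝ) + 1) ((ped K τ).gen c) +
          8 / C.E₂ * totalCostT Prod.fst C K (R K) ((ped K τ).genT c)) *
        (((L : ℝ) ^ d) * Real.exp 4) ^ partnerAges PEv.step ((ped K τ).gen c) :=
    fun z => htwin K hK τ hτT c hc hcons (hstep K hK τ hτT c hc) _ _ c₀ ρ z
  -- the largest counted set over the root data realises the uniform natural bound
  obtain ⟨z₀, -, hz₀⟩ := Finset.exists_mem_eq_sup (univ : Finset (TCell d (n * L ^ K) × Template d (M K)))
    ⟨c₀, mem_univ _⟩ (fun z => (S (zoneP n L K (levelOf (s K) K) 32 c₀) ρ c₀ PEv.step ((ped K τ).sortR.gen c) z).card)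
  have hB : ∀ z, (S (zoneP n L K (levelOf (s K) K) 32 c₀) ρ c₀ PEv.step ((ped K τ).sortR.gen c) z).card ≤
      (univ : Finset (TCell d (n * L ^ K) × Template d (M K))).sup
        (fun z => (S (zoneP n L K (levelOf (s K) K) 32 c₀) ρ c₀ PEv.step ((ped K τ).sortR.gen c) z).card) :=
    fun z => Finset.le_sup (f := fun z =>
      (S (zoneP n L K (levelOf (s K) K) 32 c₀) ρ c₀ PEv.step ((ped K τ).sortR.gen c) z).card) (mem_univ z)
  -- the image count
  have hcount := card_koccOf_le hn hL3 M hM s ped cellP liveC jstar T R c₀ ρ hL0 hρ (hs K hK) (hdrop K hK) hH hRS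
    hreal (H.inBox K hK) (hstep K hK) (hMf K hK) (hdis K hK) hτT c hD hB
  rw [hz₀] at hcount
  have hA0 : (0 : ℝ) < A d (M K) (tcap d ((ped K τ).sortR.gen c).root.fat) := by
    exact_mod_cast one_le_A (hM K) (one_le_tcap d _)
  have hreal_count : ((koccOf ped liveC (cellOfR n L s ped cellP) (physV n L hn hL0 M hM s ped cellP) jstar T K
      (kslot (keyOf ped (cellOfR n L s ped cellP) (physV n L hn hL0 M hM s ped cellP) K τ c))).card : ℝ) ≤
      (A d (M K) (tcap d ((ped K τ).sortR.gen c).root.fat) : ℝ) *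
        (Real.exp (Θ₀ * bsum (fun b => ((b.fat : ℕ) : ℝ) + 1) ((ped K τ).gen c) +
            8 / C.E₂ * totalCostT Prod.fst C K (R K) ((ped K τ).genT c)) *
          (((L : ℝ) ^ d) * Real.exp 4) ^ partnerAges PEv.step ((ped K τ).gen c)) := by
    have h1 : ((koccOf ped liveC (cellOfR n L s ped cellP) (physV n L hn hL0 M hM s ped cellP) jstar T K
        (kslot (keyOf ped (cellOfR n L s ped cellP) (physV n L hn hL0 M hM s ped cellP) K τ c))).card : ℝ) ≤
        (A d (M K) (tcap d ((ped K τ).sortR.gen c).root.fat) : ℝ) *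
          ((S (zoneP n L K (levelOf (s K) K) 32 c₀) ρ c₀ PEv.step ((ped K τ).sortR.gen c) z₀).card : ℝ) := by
      exact_mod_cast hcount
    exact h1.trans (mul_le_mul_of_nonneg_left (htwin z₀) hA0.le)
  -- the letters: `bsum = birthLinT`, `partnerAges` through the tag-forgetting map
  rw [← birthLinT_genT (ped K τ) (H.forest K hK τ hτT) c hcons, partnerAges_gen (ped K τ) c] at hreal_count
  -- repackaging: the template factor and `e^4` per partner-age unit join the exponent
  have hpack := le_exp_mul_pow_of_twin hA0 hreal_count
  refine hpack.trans (mul_le_mul_of_nonneg_right (Real.exp_le_exp.2 ?_) (pow_nonneg (pow_nonneg (Nat.cast_nonneg _) _) _))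
  -- the template factor is class-linear: `log A ≤ 8·2^d·log(2d+1)·birthLinT`
  have hlog0 : 0 ≤ Real.log (2 * (d : ℝ) + 1) := Real.log_nonneg (by norm_cast; omega)
  have hbL : ((((ped K τ).sortR.gen c).root.fat : ℕ) : ℝ) + 1 ≤ birthLinT Prod.fst ((ped K τ).genT c) := by
    rw [birthLinT_genT (ped K τ) (H.forest K hK τ hτT) c hcons, ← bsum_gen_sortR (ped K τ) _ (H.headOldest K hK τ hτT) c]
    exact fat_root_add_one_le_bsum _
  have hbL0 : 0 ≤ birthLinT Prod.fst ((ped K τ).genT c) := le_trans (by positivity) hbL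
  have hlogA : Real.log (A d (M K) (tcap d ((ped K τ).sortR.gen c).root.fat) : ℝ) ≤
      8 * 2 ^ d * Real.log (2 * d + 1) * birthLinT Prod.fst ((ped K τ).genT c) := by
    have h1 : Real.log (A d (M K) (tcap d ((ped K τ).sortR.gen c).root.fat) : ℝ) ≤
        2 * Real.log (2 * d + 1) * (tcap d ((ped K τ).sortR.gen c).root.fat : ℕ) :=
      (Real.log_le_iff_le_exp hA0).2 (A_le_exp d (M K) _)
    have h2 : ((tcap d ((ped K τ).sortR.gen c).root.fat : ℕ) : ℝ) ≤
        4 * 2 ^ d * (((((ped K τ).sortR.gen c).root.fat : ℕ) : ℝ) + 1) := tcap_le_real d _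
    have h3 : ((tcap d ((ped K τ).sortR.gen c).root.fat : ℕ) : ℝ) ≤
        4 * 2 ^ d * birthLinT Prod.fst ((ped K τ).genT c) :=
      h2.trans (mul_le_mul_of_nonneg_left hbL (by positivity))
    calc _ ≤ 2 * Real.log (2 * d + 1) * (tcap d ((ped K τ).sortR.gen c).root.fat : ℕ) := h1
      _ ≤ 2 * Real.log (2 * d + 1) * (4 * 2 ^ d * birthLinT Prod.fst ((ped K τ).genT c)) :=
          mul_le_mul_of_nonneg_left h3 (by positivity)
      _ = _ := by ring
  have hθb := mul_le_mul_of_nonneg_right hθ hbL0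
  nlinarith [hlogA, hθb, hbL0, hlog0]

/-- **FIDELITY**: the tree's `card_koccOf_le_exp` — statement VERBATIM (binders, constant `ΘJ d sS θc` at collar 32,
conclusion) — recovered from the generic instance with `htwin` supplied by the twin END
`HistoryJoinsPlacedTwin.card_S_sortR_le_exp_pow`; a kernel check that the generic statement is the right one (an `example`,
since the statement IS the landed `card_koccOf_le_exp`; the three-line lambda is the PATTERN for every supplier). [folklore] -/
example (hn : 0 < n) (hL0 : 0 < L) (hL4 : 4 ≤ L) (hn₁ : 13 ≤ C.n₁) (hE₂ : 0 < C.E₂)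
    (hE₃ : 0 ≤ C.E₃) {M : ℕ → ℕ} (hM : ∀ K, 1 ≤ M K)
    (hs : ∀ K, K₀ ≤ K → ∀ t, s K (t + 1) ≤ s K t) (hdrop : ∀ K, K₀ ≤ K → ∀ m, DropCtl (s K) m)
    (hR1 : ∀ K, K₀ ≤ K → ∀ t, 1 ≤ R K t)
    (H : RealisedDomainsR L s n K₀ R T ped cellP liveC Zd)
    (hstep : ∀ K, K₀ ≤ K → ∀ τ ∈ T K, ∀ c ∈ liveC K τ, (ped K τ).step c ≤ K)
    (hMf : ∀ K, K₀ ≤ K → ∀ τ ∈ T K, ∀ c ∈ liveC K τ, ∀ bz ∈ ((ped K τ).toPGen (cellP K τ) c).pbirths,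
      tcap d bz.1.fat ≤ M K)
    (jstar : ℕ → ℕ)
    (hdis : ∀ K, K₀ ≤ K → ∀ τ ∈ badTerms (memOf ped liveC (cellOfR n L s ped cellP)) jstar T K, ∀ c ∈ liveC K τ,
      (physV n L hn hL0 M hM s ped cellP K τ c).Nodup)
    -- the count's stride and decay, with their arithmetic side conditions (symbolic)
    {sS : ℕ} (hsS : 1 ≤ sS)
    (hsmall : (((2 * cth 32 1 sS + 1) ^ d : ℕ) : ℝ) * (5 : ℝ) ^ d * ((max 1 (2 * 32 + 2) : ℕ) : ℝ) ≤
      (L : ℝ) ^ (sS / 2) / 2)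
    {θc : ℝ} (hθc0 : 0 ≤ θc) (hθc1 : θc < 1) (hθcs : 1 / 2 ≤ θc ^ sS)
    {θ : ℝ} (hθ : (2 +
            ((2 * (((2 * cth 32 1 sS + 1) ^ d : ℕ) : ℝ) * ((((2 * 32 + 1) ^ d : ℕ) : ℝ) * (4 * 2 ^ d)) +
                  4 * ((((2 * cth 32 1 sS + 1) ^ d : ℕ) : ℝ) * (5 : ℝ) ^ d)) / (1 - θc) +
              2 * (2 * ((((2 * cth 32 1 sS + 1) ^ d : ℕ) : ℝ) * (5 : ℝ) ^ d))) +
            (2 * ((0 + 2 * Real.log (2 * d + 1)) + (2 * (d : ℝ) + 2 * Real.log (2 * d + 1)) *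
                  (((max 1 (2 * 32 + 2) : ℕ) : ℝ) * (2 * ((((2 * cth 32 1 sS + 1) ^ d : ℕ) : ℝ) * (5 : ℝ) ^ d)))) +
              (2 * (d : ℝ) + 2 * Real.log (2 * d + 1)) * 1 *
                (((max 1 (2 * 32 + 2) : ℕ) : ℝ) *
                    ((2 * (((2 * cth 32 1 sS + 1) ^ d : ℕ) : ℝ) * ((((2 * 32 + 1) ^ d : ℕ) : ℝ) * (4 * 2 ^ d)) +
                        4 * ((((2 * cth 32 1 sS + 1) ^ d : ℕ) : ℝ) * (5 : ℝ) ^ d)) / (1 - θc)) +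
                  4 * 2 ^ d)) +
            10) + 8 * 2 ^ d * Real.log (2 * d + 1) ≤ θ)
    {K : ℕ} (hK : K₀ ≤ K) {τ : ι} (hτ : τ ∈ badTerms (memOf ped liveC (cellOfR n L s ped cellP)) jstar T K)
    {c : α} (hc : c ∈ liveC K τ) :
    ((koccOf ped liveC (cellOfR n L s ped cellP) (physV n L hn hL0 M hM s ped cellP) jstar T K
        (kslot (keyOf ped (cellOfR n L s ped cellP) (physV n L hn hL0 M hM s ped cellP) K τ c))).card : ℝ) ≤
      Real.exp (θ * birthLinT Prod.fst ((ped K τ).genT c) +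
          (8 / C.E₂ * totalCostT Prod.fst C K (R K) ((ped K τ).genT c) +
            4 * (partnerAges (PEv.step ∘ Prod.fst) ((ped K τ).genT c) : ℝ))) *
        ((L : ℝ) ^ d) ^ partnerAges (PEv.step ∘ Prod.fst) ((ped K τ).genT c) := by
  refine card_koccOf_le_exp_of_twin hn hL0 hL4 hn₁ hM hs hdrop hR1 H hstep hMf jstar hdis
    (fun K' hK' τ' hτ' c' hc' hcons hKs Mz Dz c₀ ρ z => ?_) hθ hK hτ hc
  have hlv : LevelFn K' (levelOf (s K') K') := levelFn_levelOf (fun t _ => hs K' hK' t) (hdrop K' hK' K')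
  have hφ : ∀ m, m ≤ K' → C.E₂ ≤ floorK C K' (R K') m := fun m hm => by
    simpa using le_floorK_of_le (C := C) (K := K') (R := R K') hE₂.le hm (hR1 K' hK' m)
  exact card_S_sortR_le_exp_pow (ped K' τ') ρ (H.headOldest K' hK' τ' hτ') (H.renew_step K' hK' τ' hτ')
    (H.forest K' hK' τ' hτ') hE₂.le hE₃ hE₂ hφ c' hcons hKs hL0 hn hlv hsS
    (fun u _ => levelFn_add_half_le hlv u sS) hsmall hθc0 hθc1 hθcs z

end Instance

end

end Summit.QuantumFields.BalabanUV.T4Continuum.HistoryAssemblyMultInstanceTwin
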